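import Summits.NavierStokesRegularity.FluidComputer.AngularGalerkinLadderLaplacian
import Literature.Analysis.FluidPDE.TaoEnstrophyLocalisationProofs

/-!
# The angular Galerkin ladder: the Casimir cut preserves divergence-free fields and gradient
# fields — the infinitesimal Helmholtz equivariance (theorems only)

Cell `ns-blowup`, seat `ns-blowup-lean` (g11). LABEL: KERNEL typing hygiene for the vocabulary of
`FluidComputer/AngularGalerkinLadder.lean` (route `Theses/AngularGalerkinLadder.lean`). WHAT THIS
IS NOT: not Navier–Stokes evidence — vector-calculus identities for smooth fields on `ℝ³`;
nothing is asserted about any rung dynamics, no profile is constructed, no crux is touched.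

## Content

The rotation generators `J_a u = e_a × u − ((e_a × x)·∇)u` act compatibly with the two summands
of the Helmholtz decomposition:

§1–§2 **Divergence.** `fderiv_angGen`:
`D(J_a u)(x) = [e_a]_× ∘ Du(x) − Du(x) ∘ [e_a]_× − D²u(x)(·)(e_a × x)`;
**`divergence_angGen`: `div (J_a u)(x) = −D(div u)(x)(e_a × x)`** — the divergence of `J_a u` is
the SCALAR rotation derivative of `div u` (the trace terms `tr([e_a]_× Du)` and `tr(Du [e_a]_×)`
cancel, and `tr D²u(x)(·)(e_a × x) = D(tr Du)(x)(e_a × x)` by Schwarz). Hence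
**`isDivFree_angGen / isDivFree_casimir / isDivFree_bandDefect`: the generators, the Casimir and
every band defect PRESERVE DIVERGENCE-FREE smooth fields**, and `IsBandLimited`-ness of a
divergence-free field is witnessed inside the divergence-free class.

§3 **Gradients.** **`angGen_gradient`: `J_a (∇φ) = ∇(−Dφ(·)(e_a × ·))`** — the generators map
gradient fields to gradient fields (of the scalar rotation derivative `K_a φ = −(e_a × x)·∇φ`);
hence so do the Casimir and the band defects: `exists_casimir_gradient`,
**`exists_bandDefect_gradient`: `∏_{j ≤ L}(𝒞 − j(j+1)) (∇φ) = ∇ψ` for a smooth `ψ`**.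

Together §2 and §3 are the infinitesimal, projection-free form of «the isotypic projections `Π_L`
commute with the Leray projector» (the Helmholtz splitting `w = v + ∇φ`, `div v = 0`, is
rotation-equivariant): the remaining clause of the structure lemma listed in the module docstring
of `AngularGalerkinLadder.lean`. The non-local statement about the Leray projector `P` itself
(uniqueness/decay classes for the Helmholtz splitting on `ℝ³`) is deliberately not typed here.

References: [cite: MajdaBertozziCUP2002, §1.2 Prop. 1.1 (iii)] (rotation covariance of the
Euler/Navier–Stokes system and of the Leray–Helmholtz decomposition); [cite: BullardGellman1954]
(vector spherical harmonics: the isotypic decomposition respects the longitudinal/transverse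
splitting).
-/

noncomputable section

namespace Summit.NavierStokesRegularity.FluidComputer

open Set MeasureTheory Filter Topology Function
open scoped ContDiff RealInnerProductSpace Laplacian
open Literature.Analysis.FluidPDE

namespace AngularLadder

variable {u v : EuclideanSpace ℝ (Fin 3) → EuclideanSpace ℝ (Fin 3)}
  {φ : EuclideanSpace ℝ (Fin 3) → ℝ} {L : ℕ} {x : EuclideanSpace ℝ (Fin 3)}

/-! ## §1 The derivative and the divergence of `J_a u` -/

/-- The derivative field of a smooth map is differentiable. [folklore] -/
private theorem differentiableAt_fderiv_of_smooth {F : Type*} [NormedAddCommGroup F]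
    [NormedSpace ℝ F] {f : EuclideanSpace ℝ (Fin 3) → F} (hf : ContDiff ℝ ∞ f)
    (x : EuclideanSpace ℝ (Fin 3)) : DifferentiableAt ℝ (fderiv ℝ f) x :=
  (contDiff_infty_iff_fderiv.1 hf).2.differentiable (by simp) x

/-- **The derivative of `J_a u`** (as a continuous linear map):
`D(J_a u)(x) = [e_a]_× ∘ Du(x) − (Du(x) ∘ [e_a]_× + D²u(x)(·)(e_a × x))`. [folklore] -/
theorem fderiv_angGen (hu : ContDiff ℝ ∞ u) (a : Fin 3) (x : EuclideanSpace ℝ (Fin 3)) :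
    fderiv ℝ (angGen a u) x = (crossCLM (axis a)).comp (fderiv ℝ u x) -
      ((fderiv ℝ u x).comp (crossCLM (axis a)) +
        (fderiv ℝ (fderiv ℝ u) x).flip (crossCLM (axis a) x)) := by
  rw [angGen_eq]
  have h1 : HasFDerivAt (fun y => crossCLM (axis a) (u y))
      ((crossCLM (axis a)).comp (fderiv ℝ u x)) x :=
    (crossCLM (axis a)).hasFDerivAt.comp x ((hu.differentiable (by simp)) x).hasFDerivAt
  have h2 : HasFDerivAt (fun y => fderiv ℝ u y (crossCLM (axis a) y))
      ((fderiv ℝ u x).comp (crossCLM (axis a)) +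
        (fderiv ℝ (fderiv ℝ u) x).flip (crossCLM (axis a) x)) x :=
    (differentiableAt_fderiv_of_smooth hu x).hasFDerivAt.clm_apply (crossCLM (axis a)).hasFDerivAt
  exact (h1.sub h2).fderiv

/-- The symmetric second derivative: `D²u(x)(·)(z) = D²u(x)(z)` as linear maps (Schwarz).
[folklore] -/
theorem fderiv_fderiv_flip_apply_eq (hu : ContDiff ℝ ∞ u) (x z : EuclideanSpace ℝ (Fin 3)) :
    (fderiv ℝ (fderiv ℝ u) x).flip z = fderiv ℝ (fderiv ℝ u) x z :=
  ContinuousLinearMap.ext fun w => by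
    rw [ContinuousLinearMap.flip_apply]
    exact fderiv_fderiv_symm hu x w z

/-- **The divergence of `J_a u` is the scalar rotation derivative of `div u`**:
`div (J_a u)(x) = −D(div u)(x)(e_a × x)` for smooth `u` — the trace terms `tr([e_a]_× ∘ Du)` and
`tr(Du ∘ [e_a]_×)` cancel, and `tr (D²u(x)(·)(e_a × x)) = D(div u)(x)(e_a × x)` by Schwarz.
[cite: MajdaBertozziCUP2002, §1.2 Prop. 1.1 (iii)] -/
theorem divergence_angGen (hu : ContDiff ℝ ∞ u) (a : Fin 3) (x : EuclideanSpace ℝ (Fin 3)) :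
    VectorCalculus.divergence (angGen a u) x =
      -fderiv ℝ (VectorCalculus.divergence u) x (crossCLM (axis a) x) := by
  have hu2 : ContDiff ℝ 2 u := contDiff_infty.1 hu 2
  rw [divergence_eq_traceCLM, fderiv_angGen hu a x, map_sub, map_add,
    fderiv_divergence_apply hu2 x, fderiv_fderiv_flip_apply_eq hu x]
  have htr : traceCLM ((crossCLM (axis a)).comp (fderiv ℝ u x)) =
      traceCLM ((fderiv ℝ u x).comp (crossCLM (axis a))) := by
    simp only [traceCLM_apply]
    exact LinearMap.trace_comp_comm' _ _
  rw [htr]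
  abel

/-! ## §2 The cut preserves divergence-free fields -/

/-- `div (f − g) = div f − div g` at a point of differentiability. [folklore] -/
private theorem divergence_fun_sub (hf : DifferentiableAt ℝ u x) (hg : DifferentiableAt ℝ v x) :
    VectorCalculus.divergence (fun y => u y - v y) x =
      VectorCalculus.divergence u x - VectorCalculus.divergence v x := by
  simp only [divergence_eq_traceCLM, fderiv_fun_sub hf hg, map_sub]

/-- `div (c • f) = c · div f` at a point of differentiability. [folklore] -/
private theorem divergence_fun_const_smul (hf : DifferentiableAt ℝ u x) (c : ℝ) :
    VectorCalculus.divergence (fun y => c • u y) x = c * VectorCalculus.divergence u x := by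
  simp only [divergence_eq_traceCLM, fderiv_fun_const_smul hf c, map_smul, smul_eq_mul]

/-- **The generators preserve divergence-free smooth fields**: `div u = 0 ⇒ div (J_a u) = 0`.
[cite: MajdaBertozziCUP2002, §1.2 Prop. 1.1 (iii)] -/
theorem isDivFree_angGen (hu : ContDiff ℝ ∞ u) (hdiv : VectorCalculus.IsDivFree u) (a : Fin 3) :
    VectorCalculus.IsDivFree (angGen a u) := by
  intro x
  have h0 : VectorCalculus.divergence u = fun _ => (0 : ℝ) := funext hdiv
  rw [divergence_angGen hu a x, h0]
  simp

/-- **The Casimir preserves divergence-free smooth fields.** [folklore] -/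
theorem isDivFree_casimir (hu : ContDiff ℝ ∞ u) (hdiv : VectorCalculus.IsDivFree u) :
    VectorCalculus.IsDivFree (casimir u) := by
  intro x
  have hd : ∀ a : Fin 3, DifferentiableAt ℝ (angGen a (angGen a u)) x := fun a =>
    ((contDiff_angGen (contDiff_angGen hu a) a).differentiable (by simp)) x
  have hz : ∀ a : Fin 3, VectorCalculus.divergence (angGen a (angGen a u)) x = 0 := fun a =>
    isDivFree_angGen (contDiff_angGen hu a) (isDivFree_angGen hu hdiv a) a x
  show VectorCalculus.divergence (fun y => -∑ a : Fin 3, angGen a (angGen a u) y) x = 0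
  rw [divergence_eq_traceCLM, fderiv_fun_neg,
    fderiv_fun_sum (A := fun a => angGen a (angGen a u)) fun a _ => hd a, map_neg, map_sum]
  simp only [← divergence_eq_traceCLM, hz, Finset.sum_const_zero, neg_zero]

/-- **Every band defect preserves divergence-free smooth fields**: `div u = 0 ⇒
div (∏_{j ≤ L}(𝒞 − j(j+1)) u) = 0`. [folklore] -/
theorem isDivFree_bandDefect (hu : ContDiff ℝ ∞ u) (hdiv : VectorCalculus.IsDivFree u) (L : ℕ) :
    VectorCalculus.IsDivFree (bandDefect L u) := by
  induction L with
  | zero => exact isDivFree_casimir hu hdiv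
  | succ L ih =>
      have hB : ContDiff ℝ ∞ (bandDefect L u) := contDiff_bandDefect hu L
      have hC : ContDiff ℝ ∞ (casimir (bandDefect L u)) := contDiff_casimir hB
      intro x
      have hsd : DifferentiableAt ℝ
          (fun y => (((L : ℝ) + 1) * ((L : ℝ) + 2)) • bandDefect L u y) x :=
        ((hB.differentiable (by simp)) x).const_smul (((L : ℝ) + 1) * ((L : ℝ) + 2))
      show VectorCalculus.divergence (fun y => casimir (bandDefect L u) y -
        (((L : ℝ) + 1) * ((L : ℝ) + 2)) • bandDefect L u y) x = 0
      rw [divergence_fun_sub ((hC.differentiable (by simp)) x) hsd,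
        divergence_fun_const_smul ((hB.differentiable (by simp)) x),
        isDivFree_casimir hB ih x, ih x, mul_zero, sub_zero]

/-- Packaged for rung solutions: the velocity slices of a rung-`L` solution (divergence-free and
smooth, by `IsClassicalNSSolutionOn`) have divergence-free Casimirs (and band defects, by
`isDivFree_bandDefect`). [folklore] -/
theorem IsRungSolutionOn.isDivFree_casimir {S : Set ℝ} {ν : ℝ}
    {w : ℝ → EuclideanSpace ℝ (Fin 3) → EuclideanSpace ℝ (Fin 3)}
    {p : ℝ → EuclideanSpace ℝ (Fin 3) → ℝ}
    {d : ℝ → EuclideanSpace ℝ (Fin 3) → EuclideanSpace ℝ (Fin 3)}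
    (h : IsRungSolutionOn S ν L w p d) {t : ℝ} (ht : t ∈ S) :
    VectorCalculus.IsDivFree (casimir (w t)) :=
  AngularLadder.isDivFree_casimir (h.2.1 t ht).1 (h.1.divFree t ht)

/-! ## §3 The cut maps gradient fields to gradient fields -/

/-- `⟪∇f(x), w⟫ = Df(x) w` (Riesz). Private twin of the tree's `inner_gradient_left`. [folklore] -/
private theorem inner_gradient_left' (f : EuclideanSpace ℝ (Fin 3) → ℝ) (x w : EuclideanSpace ℝ (Fin 3)) :
    ⟪gradient f x, w⟫ = fderiv ℝ f x w := by
  rw [gradient, InnerProductSpace.toDual_symm_apply]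

/-- `⟪D(∇φ)(x) h, w⟫ = D²φ(x)(h)(w)` for `φ ∈ C^∞` (chain rule through the Riesz isometry).
[folklore] -/
private theorem inner_fderiv_gradient_apply' (hφ : ContDiff ℝ ∞ φ) (x h w : EuclideanSpace ℝ (Fin 3)) :
    ⟪fderiv ℝ (gradient φ) x h, w⟫ = fderiv ℝ (fderiv ℝ φ) x h w := by
  set Lr : (EuclideanSpace ℝ (Fin 3) →L[ℝ] ℝ) →L[ℝ] EuclideanSpace ℝ (Fin 3) :=
    (InnerProductSpace.toDual ℝ (EuclideanSpace ℝ (Fin 3))).symm.toContinuousLinearEquiv.toContinuousLinearMap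
    with hLr
  have hLapp : ∀ ℓ : EuclideanSpace ℝ (Fin 3) →L[ℝ] ℝ,
      Lr ℓ = (InnerProductSpace.toDual ℝ (EuclideanSpace ℝ (Fin 3))).symm ℓ := fun ℓ => rfl
  have h1 : gradient φ = fun y => Lr (fderiv ℝ φ y) := rfl
  have h2 : HasFDerivAt (fun y => Lr (fderiv ℝ φ y)) (Lr.comp (fderiv ℝ (fderiv ℝ φ) x)) x :=
    Lr.hasFDerivAt.comp x (differentiableAt_fderiv_of_smooth hφ x).hasFDerivAt
  rw [h1, h2.fderiv, ContinuousLinearMap.comp_apply, hLapp, InnerProductSpace.toDual_symm_apply]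

/-- The cross product with a fixed vector is skew-adjoint: `⟪c × v, w⟫ = −⟪v, c × w⟫`.
Private twin of the tree's `inner_cross_left_eq_neg`. [folklore] -/
private theorem inner_crossCLM_left_eq_neg' (c y w : EuclideanSpace ℝ (Fin 3)) :
    ⟪crossCLM c y, w⟫ = -⟪y, crossCLM c w⟫ := by
  simp only [crossCLM_apply, cross, PiLp.inner_apply, RCLike.inner_apply, conj_trivial,
    Fin.sum_univ_three, cross_apply, Matrix.cons_val_zero, Matrix.cons_val_one,
    Matrix.cons_val_two, Matrix.head_cons, Matrix.tail_cons]
  ring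

/-- **The generators map gradients to gradients**: for smooth `φ : ℝ³ → ℝ`,
`J_a (∇φ) = ∇(K_a φ)` with the scalar rotation derivative `K_a φ (x) = −Dφ(x)(e_a × x)`
(`[J_a, ∇] = 0`: `⟪∇(K_aφ), w⟫ = −D²φ(w, e_a × x) − Dφ(e_a × w)` equals
`⟪e_a × ∇φ − D(∇φ)(e_a × x), w⟫` by skewness of `[e_a]_×` and Schwarz).
[cite: MajdaBertozziCUP2002, §1.2 Prop. 1.1 (iii)] -/
theorem angGen_gradient (hφ : ContDiff ℝ ∞ φ) (a : Fin 3) :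
    angGen a (gradient φ) = gradient fun y => -fderiv ℝ φ y (crossCLM (axis a) y) := by
  funext x
  apply ext_inner_right ℝ
  intro w
  rw [angGen_eq, inner_sub_left, inner_crossCLM_left_eq_neg', inner_gradient_left',
    inner_fderiv_gradient_apply' hφ, inner_gradient_left', fderiv_fun_neg, _root_.neg_apply,
    fderiv_fderiv_apply_clm hφ (crossCLM (axis a)) x w, fderiv_fderiv_symm hφ x w]
  ring

/-- The scalar rotation derivative of a smooth function is smooth. [folklore] -/
private theorem contDiff_scalarRot (hφ : ContDiff ℝ ∞ φ) (a : Fin 3) :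
    ContDiff ℝ ∞ fun y => -fderiv ℝ φ y (crossCLM (axis a) y) :=
  (contDiff_fderiv_apply_clm hφ (crossCLM (axis a))).neg

/-- Two vector fields on `ℝ³` with the same pairings against every vector agree (pointwise
Riesz). [folklore] -/
private theorem funext_of_inner {f g : EuclideanSpace ℝ (Fin 3) → EuclideanSpace ℝ (Fin 3)}
    (h : ∀ x w, ⟪f x, w⟫ = ⟪g x, w⟫) : f = g :=
  funext fun x => ext_inner_right ℝ (h x)

/-- **The Casimir maps gradients to gradients**, with the explicit potential
`−Σ_a K_a (K_a φ)`, `K_a ψ = −Dψ(·)(e_a × ·)`. [folklore] -/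
theorem casimir_gradient (hφ : ContDiff ℝ ∞ φ) :
    casimir (gradient φ) = gradient fun y => -∑ a : Fin 3,
      -fderiv ℝ (fun z => -fderiv ℝ φ z (crossCLM (axis a) z)) y (crossCLM (axis a) y) := by
  have hK : ∀ a : Fin 3, ContDiff ℝ ∞ fun z => -fderiv ℝ φ z (crossCLM (axis a) z) :=
    fun a => contDiff_scalarRot hφ a
  have hKK : ∀ a : Fin 3, ContDiff ℝ ∞ fun y =>
      -fderiv ℝ (fun z => -fderiv ℝ φ z (crossCLM (axis a) z)) y (crossCLM (axis a) y) :=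
    fun a => contDiff_scalarRot (hK a) a
  have hJJ : ∀ a : Fin 3, angGen a (angGen a (gradient φ)) = gradient fun y =>
      -fderiv ℝ (fun z => -fderiv ℝ φ z (crossCLM (axis a) z)) y (crossCLM (axis a) y) :=
    fun a => by rw [angGen_gradient hφ a, angGen_gradient (hK a) a]
  refine funext_of_inner fun x w => ?_
  have hd : ∀ a : Fin 3, DifferentiableAt ℝ (fun y =>
      -fderiv ℝ (fun z => -fderiv ℝ φ z (crossCLM (axis a) z)) y (crossCLM (axis a) y)) x :=
    fun a => ((hKK a).differentiable (by simp)) x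
  simp only [casimir, hJJ, inner_neg_left, sum_inner, inner_gradient_left']
  rw [fderiv_fun_neg, _root_.neg_apply, fderiv_fun_sum fun a _ => hd a, _root_.sum_apply]

/-- **The Casimir maps gradient fields to gradient fields** (existential form). [folklore] -/
theorem exists_casimir_gradient (hφ : ContDiff ℝ ∞ φ) :
    ∃ ψ : EuclideanSpace ℝ (Fin 3) → ℝ, ContDiff ℝ ∞ ψ ∧ casimir (gradient φ) = gradient ψ :=
  ⟨_, (ContDiff.sum fun a _ => contDiff_scalarRot (contDiff_scalarRot hφ a) a).neg,
    casimir_gradient hφ⟩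

/-- **Every band defect maps gradient fields to gradient fields**: for smooth `φ` there is a
smooth `ψ` with `∏_{j ≤ L}(𝒞 − j(j+1)) (∇φ) = ∇ψ` — the isotypic cut acts on potentials.
[cite: BullardGellman1954] -/
theorem exists_bandDefect_gradient (hφ : ContDiff ℝ ∞ φ) (L : ℕ) :
    ∃ ψ : EuclideanSpace ℝ (Fin 3) → ℝ, ContDiff ℝ ∞ ψ ∧ bandDefect L (gradient φ) = gradient ψ := by
  induction L with
  | zero => exact exists_casimir_gradient hφ
  | succ L ih =>
      obtain ⟨ψ, hψ, hL⟩ := ih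
      obtain ⟨χ, hχ, hC⟩ := exists_casimir_gradient hψ
      refine ⟨fun y => χ y - (((L : ℝ) + 1) * ((L : ℝ) + 2)) * ψ y,
        hχ.sub (contDiff_const.mul hψ), ?_⟩
      refine funext_of_inner fun x w => ?_
      have hψd : DifferentiableAt ℝ ψ x := (hψ.differentiable (by simp)) x
      have hχd : DifferentiableAt ℝ χ x := (hχ.differentiable (by simp)) x
      change ⟪casimir (bandDefect L (gradient φ)) x -
          (((L : ℝ) + 1) * ((L : ℝ) + 2)) • bandDefect L (gradient φ) x, w⟫ = _
      rw [hL, hC, inner_sub_left, inner_smul_left, inner_gradient_left', inner_gradient_left',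
        inner_gradient_left', fderiv_fun_sub hχd (hψd.const_mul _), _root_.sub_apply,
        fderiv_const_mul hψd, _root_.smul_apply, smul_eq_mul]
      simp

end AngularLadder

end Summit.NavierStokesRegularity.FluidComputer

end
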